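import Summits.Ventures.CertifiedArithmetic.LowPrec.AccumulateTree
import Summits.Ventures.CertifiedArithmetic.LowPrec.EnvelopeStructural
import Literature.ComputerArithmetic.JeannerodRump2018.Theorem41

/-!
# The Jeannerod–Rump constant for the formats: any-order summation error `≤ (n-1)·u/(1+u)·Σ|xᵢ|`

HONEST FRAMING (venture CertifiedArithmetic / cell `pub-lowprec`): certified error envelopes and
provably optimal rounding/accumulation schemes for low-precision formats under stated cost models;
every table by two implementations; no hardware or vendor claims.

The proof of [JeannerodRump2018, Thm 4.1] (formalized in
`Literature/ComputerArithmetic/JeannerodRump2018/Theorem41.lean`) uses only two local facts about a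
rounded addition of two floats: `|e| ≤ u/(1+u)·|a+b|` and `|e| ≤ |a|, |b|`. Both hold for the
bit-level `roundNE α` of a `Format` with `emaxCode ≥ 2` AS LONG AS THE SUM IS IN RANGE
(`abs_err_roundNE_add_le_sharp`, from `EnvelopeStructural` + exactness of small sums; and
`abs_err_roundNE_add_le_abs`, from `roundNE_nearest`). Hence the SHARP any-order bound holds for
every evaluation tree in every OCP/IEEE format of the venture, leaves in `F_α`, nodes in range:
`Σ|eᵢ| ≤ (n-1)·u/(1+u)·Σ|xᵢ|` and `|ŝ - s| ≤ (n-1)·u/(1+u)·Σ|xᵢ|` (`absErr_flα_le`,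
`abs_eval_sub_exact_le_sharp`) — R2 (worst case, any order incl. sequential/pairwise/blocked) with
the best constant in print, as a theorem about the actual formats.
-/

namespace Literature.ComputerArithmetic.FloatingPoint

namespace MiniFloat

open Literature.ComputerArithmetic.JeannerodRump2018
open Literature.ComputerArithmetic.JeannerodRump2018.SumTree

variable {α : Format}

/-- Local fact 1 for the formats: an in-range rounded sum of two values has relative error at most
`u/(1+u)` (small sums are exact, normal-range sums obey the sharp bound). [folklore] -/
theorem abs_err_roundNE_add_le_sharp (hα : 2 ≤ α.emaxCode) (a b : MiniFloat α)
    (h : |a.toRat + b.toRat| ≤ α.maxRat) :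
    |(roundNE α (a.toRat + b.toRat)).toRat - (a.toRat + b.toRat)|
      ≤ α.unitRoundoff / (1 + α.unitRoundoff) * |a.toRat + b.toRat| := by
  have hu := α.unitRoundoff_pos
  by_cases hsmall : |a.toRat + b.toRat| < 2 ^ (α.manBits + 1) * α.quantum
  · have := errAdd_eq_zero_of_small hα a b hsmall
    unfold errAdd at this
    rw [this, abs_zero]
    exact mul_nonneg (div_nonneg hu.le (by linarith)) (abs_nonneg _)
  · rw [abs_sub_comm]
    refine abs_sub_roundNE_le_sharp (le_trans ?_ (not_lt.mp hsmall)) h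
    rw [pow_succ]
    nlinarith [α.quantum_pos, pow_pos (show (0:ℚ) < 2 by norm_num) α.manBits]

/-- Local fact 2 for the formats: the error of a rounded sum is at most the magnitude of either
operand (the other operand is a finite value, hence a rounding candidate). [folklore] -/
theorem abs_err_roundNE_add_le_abs (a b : MiniFloat α) :
    |(roundNE α (a.toRat + b.toRat)).toRat - (a.toRat + b.toRat)| ≤ |b.toRat| := by
  have h := roundNE_nearest (φ := α) (a.toRat + b.toRat) a
  rw [abs_sub_comm] at h
  simpa using h

/-- THE JEANNEROD–RUMP INDUCTION FOR THE FORMATS: for an evaluation tree whose leaves are values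
of `α` and whose nodes stay in range, `Σ|eᵢ| ≤ (n-1)·u/(1+u)·Σ|xᵢ|`. [folklore] -/
theorem absErr_flα_le (hα : 2 ≤ α.emaxCode) :
    ∀ t : SumTree, TreeInRange α t →
      absErr (flα α) t ≤ ((t.leaves.length : ℚ) - 1)
        * (α.unitRoundoff / (1 + α.unitRoundoff)) * absSum t
  | .leaf x, _ => by simp [absErr, SumTree.localErrors, SumTree.leaves]
  | .node l r, ⟨hl, hr, hrange⟩ => by
      have ihl := absErr_flα_le hα l hl
      have ihr := absErr_flα_le hα r hr
      obtain ⟨yl, hyl⟩ := exists_toRat_eq_eval l hl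
      obtain ⟨yr, hyr⟩ := exists_toRat_eq_eval r hr
      set u' := α.unitRoundoff / (1 + α.unitRoundoff) with hu'
      have hupos := α.unitRoundoff_pos
      have hu'0 : 0 ≤ u' := div_nonneg hupos.le (by linarith)
      have hu'1 : u' ≤ 1 := by rw [hu', div_le_one (by linarith)]; linarith
      set S1 := absSum l; set S2 := absSum r
      set E1 := absErr (flα α) l; set E2 := absErr (flα α) r
      set n1 : ℚ := (l.leaves.length : ℚ) with hn1d
      set n2 : ℚ := (r.leaves.length : ℚ) with hn2d
      have hn1 : (1 : ℚ) ≤ n1 := by rw [hn1d]; exact_mod_cast one_le_length_leaves l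
      have hn2 : (1 : ℚ) ≤ n2 := by rw [hn2d]; exact_mod_cast one_le_length_leaves r
      have hS1 := absSum_nonneg l; have hS2 := absSum_nonneg r
      have hE1 := absErr_nonneg (flα α) l; have hE2 := absErr_nonneg (flα α) r
      set e := |flα α (SumTree.eval (flα α) l + SumTree.eval (flα α) r)
        - (SumTree.eval (flα α) l + SumTree.eval (flα α) r)| with he
      -- the three local bounds, via the data yl, yr carrying the subtree values
      have hrange' : |yl.toRat + yr.toRat| ≤ α.maxRat := by rw [hyl, hyr]; exact hrange
      have b0 : e ≤ u' * |SumTree.eval (flα α) l + SumTree.eval (flα α) r| := by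
        have := abs_err_roundNE_add_le_sharp hα yl yr hrange'
        rw [hyl, hyr] at this; exact this
      have b2 : e ≤ |SumTree.eval (flα α) r| := by
        have := abs_err_roundNE_add_le_abs yl yr; rw [hyl, hyr] at this; exact this
      have b1 : e ≤ |SumTree.eval (flα α) l| := by
        have := abs_err_roundNE_add_le_abs yr yl
        rw [hyl, hyr, add_comm (SumTree.eval (flα α) r)] at this
        exact this
      have a1 := abs_eval_le (flα α) l
      have a2 := abs_eval_le (flα α) r
      have b0' : e ≤ u' * (S1 + E1 + S2 + E2) :=
        le_trans b0 (mul_le_mul_of_nonneg_left (le_trans (abs_add_le _ _) (by linarith)) hu'0)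
      rw [absErr_node, absSum_node]
      have hlen : ((SumTree.node l r).leaves.length : ℚ) = n1 + n2 := by
        simp [SumTree.leaves, List.length_append]; rfl
      rw [hlen]
      show E1 + E2 + e ≤ (n1 + n2 - 1) * u' * (S1 + S2)
      by_cases c1 : S2 < u' * S1
      · have hb : e ≤ S2 + E2 := le_trans b2 a2
        have t1 : 0 ≤ n2 * (u' * S1 - S2) := mul_nonneg (by linarith) (by linarith)
        have t2 : 0 ≤ S2 * ((n2 - 1) * (1 - u')) := mul_nonneg hS2 (mul_nonneg (by linarith) (by linarith))
        have t3 : 0 ≤ S2 * (n1 * u') := mul_nonneg hS2 (mul_nonneg (by linarith) hu'0)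
        have i1 : E1 ≤ (n1 - 1) * u' * S1 := ihl
        have i2 : E2 ≤ (n2 - 1) * u' * S2 := ihr
        nlinarith
      by_cases c2 : S1 < u' * S2
      · have hb : e ≤ S1 + E1 := le_trans b1 a1
        have t1 : 0 ≤ n1 * (u' * S2 - S1) := mul_nonneg (by linarith) (by linarith)
        have t2 : 0 ≤ S1 * ((n1 - 1) * (1 - u')) := mul_nonneg hS1 (mul_nonneg (by linarith) (by linarith))
        have t3 : 0 ≤ S1 * (n2 * u') := mul_nonneg hS1 (mul_nonneg (by linarith) hu'0)
        have i1 : E1 ≤ (n1 - 1) * u' * S1 := ihl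
        have i2 : E2 ≤ (n2 - 1) * u' * S2 := ihr
        nlinarith
      · have c1' : u' * S1 ≤ S2 := not_lt.mp c1
        have c2' : u' * S2 ≤ S1 := not_lt.mp c2
        have t1 : 0 ≤ u' * ((n2 - 1) * (S1 - u' * S2)) :=
          mul_nonneg hu'0 (mul_nonneg (by linarith) (by linarith))
        have t2 : 0 ≤ u' * ((n1 - 1) * (S2 - u' * S1)) :=
          mul_nonneg hu'0 (mul_nonneg (by linarith) (by linarith))
        have i1 : (1 + u') * E1 ≤ (1 + u') * ((n1 - 1) * u' * S1) :=
          mul_le_mul_of_nonneg_left ihl (by linarith)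
        have i2 : (1 + u') * E2 ≤ (1 + u') * ((n2 - 1) * u' * S2) :=
          mul_le_mul_of_nonneg_left ihr (by linarith)
        nlinarith

/-- R2, ANY ORDER, SHARP CONSTANT: for every format `α` with `emaxCode ≥ 2`, every evaluation tree
with leaves in `F_α` and nodes in range, `|ŝ - s| ≤ (n - 1)·u/(1+u)·Σ|xᵢ|` (`n` leaves) —
the Jeannerod–Rump bound for the venture's bit-level formats. [folklore] -/
theorem abs_eval_sub_exact_le_sharp (hα : 2 ≤ α.emaxCode) (t : SumTree) (ht : TreeInRange α t) :
    |SumTree.eval (flα α) t - SumTree.exact t|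
      ≤ ((t.leaves.length : ℚ) - 1) * (α.unitRoundoff / (1 + α.unitRoundoff)) * absSum t :=
  le_trans (abs_eval_sub_exact_le (flα α) t) (absErr_flα_le hα t ht)

end MiniFloat

end Literature.ComputerArithmetic.FloatingPoint
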